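import Mathlib
import HarnessLib
import Literature.MathematicalPhysics.QuantumLattice.GaugeGroups
import Literature.MathematicalPhysics.QuantumFieldTheory.ConstructiveQFTWave0
import Literature.MathematicalPhysics.QuantumFieldTheory.LatticeGaugeProofs
import Literature.MathematicalPhysics.QuantumFieldTheory.U1GinibreComparison
import Literature.MathematicalPhysics.QuantumLattice.AbelianFieldTensor
import Literature.MathematicalPhysics.QuantumLattice.AbelianMagneticFlux
import Summits.Ventures.LatticeQCDFlow.Exactness.SymmetricMetropolis
import Summits.Ventures.LatticeQCDFlow.Scaling.LatticePeeling
import Summits.Ventures.LatticeQCDFlow.Scaling.BoxPeel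
import Summits.Ventures.LatticeQCDFlow.Scaling.FluxPatch
import Summits.Ventures.LatticeQCDFlow.Scaling.FluxSectorCollar
import Summits.Ventures.LatticeQCDFlow.Scaling.FluxTunnellingU1Explicit
import Summits.Ventures.LatticeQCDFlow.Scaling.RowFields
import Summits.Ventures.LatticeQCDFlow.Scaling.BoxSpreadWitness
import Summits.Ventures.LatticeQCDFlow.Scaling.BoxTouch
import Summits.Ventures.LatticeQCDFlow.Scaling.FluxTunnellingU1MaxPlaquette
import Summits.Ventures.LatticeQCDFlow.Scaling.FluxInsertionKernel
import Summits.Ventures.LatticeQCDFlow.Scaling.FluxInsertionLine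

/-!
# The `l`-block flux insertion under the 2-d `U(1)` Wilson measure: a volume-uniform bracket

HONEST FRAMING: exact (Metropolis-corrected) sampling algorithms for lattice gauge theory;
figures of merit are autocorrelation/cost numbers at stated couplings and volumes; no
continuum-physics claim.

Venture `LatticeQCDFlow` (cell pub-lqcd), topic `Scaling`, FANOUT row 29 (theory2, gen-19), item 100.
NEW WORK over Mathlib, row 9's `Exactness/SymmetricMetropolis` and items 92/94/95/97/98/99; nothing
here is cited as a fact.  Printed counterpart, named only: the instanton-insertion move of
[AlbandeaEtAl2021, §3], here supported on ONE `l × l` block.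

`W = boxSpread l` (item 94: supported on `boxLinks 1 l`, `N = (l−1)(l+3)` plaquettes of angle
`α_l = 2π/N`, flux charge `+1`).  The kernel `boxInsertionMH β l = insertionMH (boxSpread l) e^{−βS}`
(item 98) proposes `U ↦ W^{±1}U` and Metropolis-filters.  With `2 ≤ l`, `l + 1 ≤ L`, `L` even, `β ≥ 0`:

* `wilsonAction_boxSpread`: `S(W) = N(1 − cos α_l)`;
* `boxInsertionMH_invariant`, `ae_boxInsertionMH_eq_off`: EXACT for `μ_{β,L}` and supported on the block;
* `u1_boxInsertion_floor`:
  `z₁(β)² (μ_{β,L} ⊗ K){Q ≠ Q'} ≥ ½ e^{−βN(1 − cos α_l)} (z₁(β)² − N e^{−β(1 + cos α_l)})`;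
* `u1_boxInsertion_bracket`: together with item 97's ceiling `2N e^{−β(1 − cos(π/N))}`.

EVERY QUANTITY IN THE BRACKET IS INDEPENDENT OF THE VOLUME `L` (`L ≥ l + 1`): at fixed coupling an
exact, block-local move tunnels between flux sectors at a rate bounded below uniformly in the volume,
and no block-local exact move does better than the ceiling, also uniformly in the volume.  In `β` the
two exponents are `βN(1 − cos(2π/N)) → 2π²β/N` (floor) and `βN(1 − cos(π/N)) → π²β/(2N)` (ceiling).

HONEST SCOPE: `U(1)`, d = 2; a per-step tunnelling probability of ONE explicit kernel, not a mixing
time; the real-number form needs `β ≥ 1` and is informative only once `N·e·π²·β·e^{−β(1+cos α_l)} < 1`.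
-/

noncomputable section

namespace Summit.Ventures.LatticeQCDFlow.Theory2.Lattice.Flux

open MeasureTheory ProbabilityTheory Real
open scoped ENNReal
open Literature.MathematicalPhysics.QuantumFieldTheory Literature.MathematicalPhysics.QuantumLattice
open Summit.Ventures.LatticeQCDFlow.Exactness

variable {L : ℕ} [NeZero L] {l : ℕ}

/-! ## §1 The action and the inverse of the box spread -/

omit [NeZero L] in
/-- `1 − cos(boxF) = boxF · (1 − cos α_l)/α_l` (`boxF ∈ {0, α_l}`). [folklore] -/
theorem one_sub_cos_boxF (hl : 2 ≤ l) (a b : ℕ) :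
    1 - Real.cos (boxF l a b) = boxF l a b * ((1 - Real.cos (boxAlpha l)) / boxAlpha l) := by
  have hα := boxAlpha_pos hl
  unfold boxF
  split_ifs
  · field_simp
  · simp

/-- The total angle of the spread, summed over the torus: `2π`. [folklore] -/
theorem sum_boxF_site (hl : 2 ≤ l) (hlL : l + 1 ≤ L) :
    ∑ x : Site 2 L, boxF l (x 0).val (x 1).val = 2 * π := by
  rw [Fintype.sum_equiv (piFinTwoEquiv fun _ => ZMod L) (fun x : Site 2 L => boxF l (x 0).val (x 1).val)
    (fun ab : ZMod L × ZMod L => boxF l ab.1.val ab.2.val) (fun x => rfl), Fintype.sum_prod_type]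
  show ∑ a : ZMod L, ∑ b : ZMod L, boxF l a.val b.val = 2 * π
  have hinner : ∀ a : ZMod L, ∑ b : ZMod L, boxF l a.val b.val =
      ∑ j ∈ Finset.range L, boxF l a.val j := fun a => sum_zmod_val (boxF l a.val)
  simp only [hinner]
  rw [sum_zmod_val (fun i => ∑ j ∈ Finset.range L, boxF l i j), sum_boxF hl hlL]

/-- **`S(boxSpread l) = (l−1)(l+3)(1 − cos α_l)`.** [folklore] -/
theorem wilsonAction_boxSpread (hl : 2 ≤ l) (hlL : l + 1 ≤ L) :
    wilsonAction u1Rep (boxSpread l : GaugeConfig 2 L Circle) =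
      ((l : ℝ) - 1) * ((l : ℝ) + 3) * (1 - Real.cos (boxAlpha l)) := by
  rw [wilsonAction_u1_eq]
  have h1 : ∀ q : Plaquette 2 L,
      (1 - ((plaquetteHolonomy (boxSpread l) q.1 q.2.1.1 q.2.1.2 : Circle) : ℂ).re) =
        (fun x : Site 2 L => boxF l (x 0).val (x 1).val * ((1 - Real.cos (boxAlpha l)) / boxAlpha l))
          (plaquetteEquivSite q) := by
    intro q
    obtain ⟨h0, h1⟩ := plaquette_dirs_eq q
    rw [h0, h1, plaquetteHolonomy_boxSpread hl hlL, Circle.coe_exp, Complex.exp_ofReal_mul_I_re]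
    exact one_sub_cos_boxF hl _ _
  simp_rw [h1]
  rw [Fintype.sum_equiv plaquetteEquivSite
    (fun q : Plaquette 2 L => (fun x : Site 2 L =>
      boxF l (x 0).val (x 1).val * ((1 - Real.cos (boxAlpha l)) / boxAlpha l)) (plaquetteEquivSite q))
    (fun x : Site 2 L => boxF l (x 0).val (x 1).val * ((1 - Real.cos (boxAlpha l)) / boxAlpha l))
    (fun q => rfl), ← Finset.sum_mul, sum_boxF_site hl hlL]
  have hN : 2 * π / boxAlpha l = ((l : ℝ) - 1) * ((l : ℝ) + 3) := by
    obtain ⟨h1', h3'⟩ := boxDen_ne_zero hl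
    unfold boxAlpha
    field_simp
  rw [← hN]
  have hα : boxAlpha l ≠ 0 := (boxAlpha_pos hl).ne'
  field_simp

/-- The field tensor of the inverse spread is `−boxF`. [folklore] -/
theorem abelianFieldTensor_boxSpread_inv (hl : 2 ≤ l) (hlL : l + 1 ≤ L) (x : Site 2 L) :
    abelianFieldTensor (boxSpread l : GaugeConfig 2 L Circle)⁻¹ x 0 1 = -boxF l (x 0).val (x 1).val := by
  have := boxF_nonneg hl (x 0).val (x 1).val
  have := boxF_le hl (x 0).val (x 1).val
  have := boxAlpha_lt_pi hl
  refine abelianFieldTensor_eq_of_plaquette_eq_exp ?_ (by linarith) (by linarith [Real.pi_pos])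
  rw [plaquetteHolonomy_inv, plaquetteHolonomy_boxSpread hl hlL, Circle.exp_neg]

/-- The inverse spread has flux charge `−1`. [folklore] -/
theorem topCharge_boxSpread_inv (hl : 2 ≤ l) (hlL : l + 1 ≤ L) :
    topCharge (0 : Site 2 L) 0 1 (boxSpread l : GaugeConfig 2 L Circle)⁻¹ = -1 := by
  have h := topCharge_mul (0 : Site 2 L) 0 1 (U := (boxSpread l : GaugeConfig 2 L Circle))
    (V := (boxSpread l)⁻¹) (fun x => by
    rw [abelianFieldTensor_boxSpread hl hlL, abelianFieldTensor_boxSpread_inv hl hlL, add_neg_cancel]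
    exact ⟨by linarith [Real.pi_pos], Real.pi_pos.le⟩)
  rw [mul_inv_cancel, topCharge_one', topCharge_boxSpread hl hlL] at h
  linarith

/-! ## §2 The block-insertion kernel: exact and block-local -/

/-- **The block-insertion Metropolis kernel** under the Wilson weight `e^{−βS}`. [folklore] -/
def boxInsertionMH (β : ℝ) (l : ℕ) : Kernel (GaugeConfig 2 L Circle) (GaugeConfig 2 L Circle) :=
  insertionMH (boxSpread l) (u1Weight (d := 2) (L := L) β)

/-- It is a Markov kernel. [folklore] -/
instance instIsMarkovKernelBoxInsertionMH (β : ℝ) (l : ℕ) :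
    IsMarkovKernel (boxInsertionMH (L := L) β l) := by
  haveI : Fact (Measurable (u1Weight (d := 2) (L := L) β)) := ⟨measurable_u1Weight β⟩
  unfold boxInsertionMH; infer_instance

/-- **Exactness**: the Wilson measure is invariant. [folklore] -/
theorem boxInsertionMH_invariant (β : ℝ) (l : ℕ) :
    Kernel.Invariant (boxInsertionMH (L := L) β l) (wilsonMeasure (d := 2) (L := L) u1Rep β) := by
  have h : Kernel.Invariant (boxInsertionMH (L := L) β l) (wilsonWeight (d := 2) (L := L) u1Rep β) :=
    insertionMH_invariant (boxSpread l) (measurable_u1Weight β) (u1Weight_pos β)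
  unfold Kernel.Invariant at h ⊢
  rw [wilsonMeasure, Measure.bind_smul, h]

/-- **Locality**: the kernel moves only block links, under any initial law. [folklore] -/
theorem ae_boxInsertionMH_eq_off (hl : 2 ≤ l) (hlL : l + 1 ≤ L) (β : ℝ)
    (μ : Measure (GaugeConfig 2 L Circle)) [SFinite μ] :
    ∀ᵐ q ∂(μ ⊗ₘ boxInsertionMH (L := L) β l), ∀ e ∉ boxLinks (1 : Site 2 L) l, q.1 e = q.2 e := by
  refine Measure.ae_compProd_of_ae_ae (measurableSet_eq_off (boxLinks (1 : Site 2 L) l))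
    (ae_of_all _ fun U => ?_)
  have hB : MeasurableSet
      {V : GaugeConfig 2 L Circle | ¬∀ e ∉ boxLinks (1 : Site 2 L) l, U e = V e} :=
    ((measurableSet_eq_off (L := L) (boxLinks (1 : Site 2 L) l)).preimage measurable_prodMk_left).compl
  have h0 : boxInsertionMH (L := L) β l U
      {V | ¬∀ e ∉ boxLinks (1 : Site 2 L) l, U e = V e} = 0 := by
    refine insertionMH_eq_zero (boxSpread l) (measurable_u1Weight β) U hB ?_ ?_ ?_
    · simp
    · simp only [Set.mem_setOf_eq, not_not, Pi.mul_apply]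
      intro e he
      rw [boxSpread_eq_one_of_not_mem hl hlL he, one_mul]
    · simp only [Set.mem_setOf_eq, not_not, Pi.mul_apply, Pi.inv_apply]
      intro e he
      rw [boxSpread_eq_one_of_not_mem hl hlL he, inv_one, one_mul]
  rw [ae_iff]
  exact h0

/-! ## §3 The floor and the bracket -/

/-- The branch event of the block: every touching plaquette angle lies in `(α_l − π, π − α_l]`.
[folklore] -/
def boxBranch (l L : ℕ) [NeZero L] : Set (GaugeConfig 2 L Circle) :=
  {U | ∀ x : Site 2 L, inR l (x 0).val (x 1).val →
    boxAlpha l - π < abelianFieldTensor U x 0 1 ∧ abelianFieldTensor U x 0 1 ≤ π - boxAlpha l}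

omit [NeZero L] in
/-- `boxF = α_l` on the touching region. [folklore] -/
theorem boxF_of_inR {a b : ℕ} (h : inR l a b) : boxF l a b = boxAlpha l := if_pos h

omit [NeZero L] in
/-- `boxF = 0` off the touching region. [folklore] -/
theorem boxF_of_not_inR {a b : ℕ} (h : ¬inR l a b) : boxF l a b = 0 := if_neg h

/-- **On the branch event both block insertions change the charge** (by `±1`). [folklore] -/
theorem bothChange_of_boxBranch (hl : 2 ≤ l) (hlL : l + 1 ≤ L) {U : GaugeConfig 2 L Circle}
    (hU : U ∈ boxBranch l L) : U ∈ bothChange (boxSpread l) (0 : Site 2 L) 0 1 := by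
  have hα := boxAlpha_pos hl
  constructor
  · have h := topCharge_mul (0 : Site 2 L) 0 1 (U := (boxSpread l : GaugeConfig 2 L Circle)) (V := U)
      (fun x => by
      rw [abelianFieldTensor_boxSpread hl hlL]
      by_cases hx : inR l (x 0).val (x 1).val
      · rw [boxF_of_inR hx]
        obtain ⟨_, h2⟩ := hU x hx
        exact ⟨by linarith [neg_pi_lt_abelianFieldTensor U x 0 1], by linarith⟩
      · rw [boxF_of_not_inR hx, zero_add]
        exact ⟨neg_pi_lt_abelianFieldTensor U x 0 1, abelianFieldTensor_le_pi U x 0 1⟩)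
    show topCharge (0 : Site 2 L) 0 1 (boxSpread l * U) ≠ topCharge (0 : Site 2 L) 0 1 U
    rw [h, topCharge_boxSpread hl hlL]
    intro h'; linarith
  · have h := topCharge_mul (0 : Site 2 L) 0 1 (U := (boxSpread l : GaugeConfig 2 L Circle)⁻¹)
      (V := U) (fun x => by
      rw [abelianFieldTensor_boxSpread_inv hl hlL]
      by_cases hx : inR l (x 0).val (x 1).val
      · rw [boxF_of_inR hx]
        obtain ⟨h1, _⟩ := hU x hx
        exact ⟨by linarith, by linarith [abelianFieldTensor_le_pi U x 0 1]⟩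
      · rw [boxF_of_not_inR hx, neg_zero, zero_add]
        exact ⟨neg_pi_lt_abelianFieldTensor U x 0 1, abelianFieldTensor_le_pi U x 0 1⟩)
    show topCharge (0 : Site 2 L) 0 1 ((boxSpread l)⁻¹ * U) ≠ topCharge (0 : Site 2 L) 0 1 U
    rw [h, topCharge_boxSpread_inv hl hlL]
    intro h'; linarith

/-- **Off the branch event some touching plaquette is `2cos(α_l/2)`-far from `1`.** [folklore] -/
theorem exists_far_of_not_boxBranch (hl : 2 ≤ l) {U : GaugeConfig 2 L Circle}
    (hU : U ∉ boxBranch l L) :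
    ∃ p ∈ boxPositions l L, 2 * Real.cos (boxAlpha l / 2) ≤
      dist (plaquetteHolonomy U (planeSite (0 : Site 2 L) 0 1 p) 0 1) 1 := by
  simp only [boxBranch, Set.mem_setOf_eq, not_forall, not_and_or, not_lt, not_le, exists_prop] at hU
  obtain ⟨x, hx0, hx⟩ := hU
  refine ⟨(x 0, x 1), mem_boxPositions_of_inR hx0, ?_⟩
  have hxs : planeSite (0 : Site 2 L) 0 1 (x 0, x 1) = x := by
    ext i; fin_cases i <;> simp [planeSite]
  rw [hxs]
  refine two_cos_le_dist_of_pi_sub_le_abs (boxAlpha_pos hl).le (boxAlpha_lt_pi hl).le ?_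
  rcases hx with h | h
  · exact le_trans (by linarith) (neg_le_abs (abelianFieldTensor U x 0 1))
  · exact h.le.trans (le_abs_self _)

omit [NeZero L] in
/-- `(2cos(α/2))²/2 = 1 + cos α`. [folklore] -/
theorem two_cos_half_sq_div_two (α : ℝ) : (2 * Real.cos (α / 2)) ^ 2 / 2 = 1 + Real.cos α := by
  have h := Real.cos_two_mul (α / 2)
  rw [show 2 * (α / 2) = α by ring] at h
  rw [h]; ring

/-- **The Wilson probability of leaving the block branch event**:
`z₁(β)² μ_{β,L}(boxBranchᶜ) ≤ N e^{−β(1 + cos α_l)}`, `N = (l−1)(l+3)` — uniformly in `L`. [folklore] -/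
theorem u1_z1_sq_mul_measure_boxBranch_compl_le (hl : 2 ≤ l) (hlL : l + 1 ≤ L) (hLe : Even L) {β : ℝ}
    (hβ : 0 ≤ β) :
    z1 u1Rep β ^ 2 * wilsonMeasure (d := 2) (L := L) u1Rep β (boxBranch l L)ᶜ ≤
      ENNReal.ofReal (((l : ℝ) - 1) * ((l : ℝ) + 3)) *
        ENNReal.ofReal (Real.exp (-(β * (1 + Real.cos (boxAlpha l))))) := by
  have hL : 2 ≤ L := by omega
  have hcos0 : 0 ≤ Real.cos (boxAlpha l / 2) := Real.cos_nonneg_of_neg_pi_div_two_le_of_le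
    (by linarith [Real.pi_pos, boxAlpha_pos hl]) (by linarith [boxAlpha_lt_pi hl])
  have hc0 : 0 ≤ 2 * Real.cos (boxAlpha l / 2) := by positivity
  calc z1 u1Rep β ^ 2 * wilsonMeasure (d := 2) (L := L) u1Rep β (boxBranch l L)ᶜ
      ≤ z1 u1Rep β ^ 2 * wilsonMeasure (d := 2) (L := L) u1Rep β
          {U | ∃ p ∈ boxPositions l L, 2 * Real.cos (boxAlpha l / 2) ≤
            dist (plaquetteHolonomy U (planeSite (0 : Site 2 L) 0 1 p) 0 1) 1} :=
        mul_le_mul_right (measure_mono fun U hU => exists_far_of_not_boxBranch hl hU) _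
    _ ≤ (boxPositions l L).card *
          ENNReal.ofReal (Real.exp (-(β * ((2 * Real.cos (boxAlpha l / 2)) ^ 2 / 2)))) :=
        u1_z1_sq_mul_measure_exists_dist_ge_le hL hLe hβ 0 (boxPositions l L) hc0
    _ ≤ ENNReal.ofReal (((l : ℝ) - 1) * ((l : ℝ) + 3)) *
          ENNReal.ofReal (Real.exp (-(β * (1 + Real.cos (boxAlpha l))))) := by
        rw [two_cos_half_sq_div_two, ← ENNReal.ofReal_natCast]
        exact mul_le_mul_left (ENNReal.ofReal_le_ofReal (card_boxPositions_le hl)) _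

/-- **FLOOR, uniformly in the volume.**  For the block-insertion Metropolis kernel under the 2-d
`U(1)` Wilson measure (`2 ≤ l`, `l + 1 ≤ L`, `L` even, `β ≥ 0`; `N = (l−1)(l+3)`, `α_l = 2π/N`):
`z₁(β)² (μ_{β,L} ⊗ K){Q ≠ Q'} ≥ ½ e^{−βN(1 − cos α_l)} (z₁(β)² − N e^{−β(1 + cos α_l)})`. [folklore] -/
theorem u1_boxInsertion_floor (hl : 2 ≤ l) (hlL : l + 1 ≤ L) (hLe : Even L) {β : ℝ} (hβ : 0 ≤ β) :
    2⁻¹ * ENNReal.ofReal (Real.exp (-(β * (((l : ℝ) - 1) * ((l : ℝ) + 3) * (1 - Real.cos (boxAlpha l)))))) *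
        (z1 u1Rep β ^ 2 - ENNReal.ofReal (((l : ℝ) - 1) * ((l : ℝ) + 3)) *
          ENNReal.ofReal (Real.exp (-(β * (1 + Real.cos (boxAlpha l)))))) ≤
      z1 u1Rep β ^ 2 * ((wilsonMeasure (d := 2) (L := L) u1Rep β) ⊗ₘ boxInsertionMH (L := L) β l)
        {q | topCharge (0 : Site 2 L) 0 1 q.1 ≠ topCharge (0 : Site 2 L) 0 1 q.2} := by
  set μW := wilsonMeasure (d := 2) (L := L) u1Rep β with hμW
  haveI : IsProbabilityMeasure μW := isProbabilityMeasure_wilsonMeasure u1Rep continuous_u1Rep β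
  set Z := z1 u1Rep β ^ 2 with hZ
  set B := ENNReal.ofReal (((l : ℝ) - 1) * ((l : ℝ) + 3)) *
    ENNReal.ofReal (Real.exp (-(β * (1 + Real.cos (boxAlpha l))))) with hB
  set E := ENNReal.ofReal (Real.exp
    (-(β * (((l : ℝ) - 1) * ((l : ℝ) + 3) * (1 - Real.cos (boxAlpha l)))))) with hE
  have hfloor := compProd_insertionMH_topCharge_ne_ge hβ (boxSpread l : GaugeConfig 2 L Circle)
    (0 : Site 2 L) 0 1 μW
  rw [wilsonAction_boxSpread hl hlL] at hfloor
  have hmono : μW (boxBranch l L) ≤ μW (bothChange (boxSpread l) (0 : Site 2 L) 0 1) :=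
    measure_mono fun U hU => bothChange_of_boxBranch hl hlL hU
  have hcompl : Z * μW (boxBranch l L)ᶜ ≤ B := u1_z1_sq_mul_measure_boxBranch_compl_le hl hlL hLe hβ
  have hsplit : Z ≤ Z * μW (boxBranch l L) + B := by
    calc Z = Z * μW Set.univ := by rw [measure_univ, mul_one]
      _ ≤ Z * (μW (boxBranch l L) + μW (boxBranch l L)ᶜ) := by
          refine mul_le_mul_right ?_ _
          rw [← Set.union_compl_self (boxBranch l L)]
          exact measure_union_le _ _
      _ = Z * μW (boxBranch l L) + Z * μW (boxBranch l L)ᶜ := mul_add _ _ _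
      _ ≤ Z * μW (boxBranch l L) + B := add_le_add le_rfl hcompl
  have htsub : Z - B ≤ Z * μW (boxBranch l L) := tsub_le_iff_right.mpr hsplit
  calc 2⁻¹ * E * (Z - B) ≤ 2⁻¹ * E * (Z * μW (boxBranch l L)) := mul_le_mul_right htsub _
    _ ≤ 2⁻¹ * E * (Z * μW (bothChange (boxSpread l) (0 : Site 2 L) 0 1)) :=
        mul_le_mul_right (mul_le_mul_right hmono _) _
    _ = Z * (2⁻¹ * E * μW (bothChange (boxSpread l) (0 : Site 2 L) 0 1)) := by ring
    _ ≤ Z * (μW ⊗ₘ boxInsertionMH (L := L) β l)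
          {q | topCharge (0 : Site 2 L) 0 1 q.1 ≠ topCharge (0 : Site 2 L) 0 1 q.2} :=
        mul_le_mul_right hfloor _

/-- **BRACKET, uniformly in the volume.**  Floor (this file) and ceiling (item 97's block law
applied to this exact, block-local kernel), `N = (l−1)(l+3)`:
`½ e^{−βN(1−cos(2π/N))}(z₁² − N e^{−β(1+cos(2π/N))}) ≤ z₁² P{Q ≠ Q'} ≤ 2N e^{−β(1−cos(π/N))}`.
[folklore] -/
theorem u1_boxInsertion_bracket (hl : 2 ≤ l) (hlL : l + 1 ≤ L) (hLe : Even L) {β : ℝ} (hβ : 0 ≤ β) :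
    2⁻¹ * ENNReal.ofReal (Real.exp (-(β * (((l : ℝ) - 1) * ((l : ℝ) + 3) * (1 - Real.cos (boxAlpha l)))))) *
        (z1 u1Rep β ^ 2 - ENNReal.ofReal (((l : ℝ) - 1) * ((l : ℝ) + 3)) *
          ENNReal.ofReal (Real.exp (-(β * (1 + Real.cos (boxAlpha l)))))) ≤
      z1 u1Rep β ^ 2 * ((wilsonMeasure (d := 2) (L := L) u1Rep β) ⊗ₘ boxInsertionMH (L := L) β l)
        {q | topCharge (0 : Site 2 L) 0 1 q.1 ≠ topCharge (0 : Site 2 L) 0 1 q.2} ∧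
    z1 u1Rep β ^ 2 * ((wilsonMeasure (d := 2) (L := L) u1Rep β) ⊗ₘ boxInsertionMH (L := L) β l)
        {q | topCharge (0 : Site 2 L) 0 1 q.1 ≠ topCharge (0 : Site 2 L) 0 1 q.2} ≤
      2 * ENNReal.ofReal ((((l : ℝ) - 1) * ((l : ℝ) + 3)) *
        Real.exp (-(β * (1 - Real.cos (π / (((l : ℝ) - 1) * ((l : ℝ) + 3))))))) := by
  haveI : IsProbabilityMeasure (wilsonMeasure (d := 2) (L := L) u1Rep β) :=
    isProbabilityMeasure_wilsonMeasure u1Rep continuous_u1Rep β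
  exact ⟨u1_boxInsertion_floor hl hlL hLe hβ,
    u1_tunnelling_boxLinks (by omega) hLe hβ hl hlL (boxInsertionMH (L := L) β l)
      (boxInsertionMH_invariant β l) (ae_boxInsertionMH_eq_off hl hlL β _)⟩

/-- **The block floor in real numbers** (`β ≥ 1`), uniformly in the volume:
`P{Q ≠ Q'} ≥ ½ e^{−βN(1 − cos α_l)} (1 − N·e·π²·β·e^{−β(1 + cos α_l)})`. [folklore] -/
theorem u1_boxInsertion_floor_real (hl : 2 ≤ l) (hlL : l + 1 ≤ L) (hLe : Even L) {β : ℝ} (hβ : 1 ≤ β) :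
    2⁻¹ * Real.exp (-(β * (((l : ℝ) - 1) * ((l : ℝ) + 3) * (1 - Real.cos (boxAlpha l))))) *
        (1 - ((l : ℝ) - 1) * ((l : ℝ) + 3) * Real.exp (-(β * (1 + Real.cos (boxAlpha l)))) *
          (Real.exp 1 * π ^ 2 * β)) ≤
      ((wilsonMeasure (d := 2) (L := L) u1Rep β) ⊗ₘ boxInsertionMH (L := L) β l).real
        {q | topCharge (0 : Site 2 L) 0 1 q.1 ≠ topCharge (0 : Site 2 L) 0 1 q.2} := by
  haveI : IsProbabilityMeasure (wilsonMeasure (d := 2) (L := L) u1Rep β) :=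
    isProbabilityMeasure_wilsonMeasure u1Rep continuous_u1Rep β
  have hN : 0 ≤ ((l : ℝ) - 1) * ((l : ℝ) + 3) := by
    have : (2 : ℝ) ≤ l := by exact_mod_cast hl
    have : 0 ≤ (l : ℝ) - 1 := by linarith
    positivity
  have H := u1_boxInsertion_floor hl hlL hLe (by linarith : (0 : ℝ) ≤ β)
  rw [← ENNReal.ofReal_mul hN] at H
  exact real_floor_of_ennreal_floor hβ (Real.exp_pos _).le (by positivity) H

end Summit.Ventures.LatticeQCDFlow.Theory2.Lattice.Flux

end
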